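import Mathlib
import Literature.NumberTheory.Sieve.ParityWave0
import HarnessLib

/-!
# Goldbach–Linnik numbers: the counting functions of Pintz–Ruzsa I

Topic `Literature/NumberTheory/Sieve`; support file for the named fact
`Literature.NumberTheory.Sieve.goldbach_linnik` (parity.S36, `ParityWave0.lean`: every sufficiently
large even `N` is a sum of two primes and at most `8` powers of two; Pintz–Ruzsa II,
Acta Math. Hungar. 161 (2020) 569–582).

This file vendors the *counting functions* of Pintz–Ruzsa, *On Linnik's approximation to
Goldbach's problem, I*, Acta Arith. 109 (2003) 169–194, §1 and §10, and proves the purely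
combinatorial last step of their proof of Theorem 1 (§10, (10.10)): with `L = [log₂ N]`,

* `repPrimePow N k n = r'_k(n) = #{(p, ν₁, …, ν_k) : n = p + 2^{ν₁} + ⋯ + 2^{ν_k}}`, `p ≤ N` an odd
  prime, `1 ≤ ν_i ≤ L` (PR I (1.2); the ranges `p ≤ N`, `ν_i ≤ L` are those of the generating
  functions `S`, `G` of PR I (2.4), (8.1));
* the odd-index moments `firstMoment N k = ∑_{n < N, 2 ∤ n} r'_k(n)`,
  `secondMoment N k = ∑_{n < N, 2 ∤ n} r'_k(n)²` (PR I (10.7), (10.1); for even `N` and odd `n`,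
  `n ≤ N ↔ n < N`);
* the pair sum `pairSum N i j = ∑_{m + n = N, 2 ∤ m, 2 ∤ n} r'_i(m) r'_j(n)` (PR I (10.10), the
  dispersion-method expression for `r''_{i+j}(N)`);
* `goldbach_linnik_of_pairSum_pos`: if `pairSum N i j > 0` for all large even `N` and `i + j ≤ 8`,
  then `goldbach_linnik` — a positive term gives `N = p₁ + p₂ + 2^{ν₁} + ⋯ + 2^{ν_{i+j}}`.

The analytic part of PR I §10 (dispersion method, Lemmas 13–14) is formalised on top of this file
in `GoldbachLinnikDispersion.lean`; nothing here is conditional. No named facts are introduced.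

## References

* J. Pintz, I. Z. Ruzsa, *On Linnik's approximation to Goldbach's problem, I*, Acta Arith. 109
  (2003) 169–194, (1.1)–(1.2), (2.4), §10 (10.10). [PintzRuzsa2003]
* J. Pintz, I. Z. Ruzsa, *On Linnik's approximation to Goldbach's problem. II*, Acta Math.
  Hungar. 161 (2020) 569–582 (K = 8 unconditionally). [PintzRuzsa2020]
-/

open Finset Filter

namespace Literature.NumberTheory.Sieve

namespace GoldbachLinnik

/-- `L = [log₂ N]`, the number of admissible exponents of `2` (Pintz–Ruzsa I (2.4)).
[cite: PintzRuzsa2003, (2.4)] -/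
def powLen (N : ℕ) : ℕ := Nat.log 2 N

/-- The odd primes `p ≤ N` (the range of summation of `S(α)` in Pintz–Ruzsa I (2.4), where `p`
always denotes an odd prime). [cite: PintzRuzsa2003, (2.4)] -/
def oddPrimes (N : ℕ) : Finset ℕ := (range (N + 1)).filter fun p => p.Prime ∧ Odd p

/-- The exponent tuples `(ν₁, …, ν_k)` with `1 ≤ ν_i ≤ L = [log₂ N]` (Pintz–Ruzsa I (8.1), §10).
[cite: PintzRuzsa2003, (8.1)] -/
def expTuples (N k : ℕ) : Finset (Fin k → ℕ) := Fintype.piFinset fun _ => Icc 1 (powLen N)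

/-- `r'_k(n) = #{(p, ν₁, …, ν_k) : n = p + 2^{ν₁} + ⋯ + 2^{ν_k}}` with `p ≤ N` an odd prime and
`1 ≤ ν_i ≤ [log₂ N]` (Pintz–Ruzsa I (1.2), with the ranges of (2.4), (8.1)).
[cite: PintzRuzsa2003, (1.2)] -/
def repPrimePow (N k n : ℕ) : ℕ :=
  ((oddPrimes N ×ˢ expTuples N k).filter fun x => x.1 + ∑ i, 2 ^ x.2 i = n).card

/-- The odd natural numbers below `N` (index set of the sums `∑_{n ≤ N, 2 ∤ n}` of Pintz–Ruzsa I
§10 when `N` is even). [cite: PintzRuzsa2003, (10.8)] -/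
def oddBelow (N : ℕ) : Finset ℕ := (range N).filter Odd

/-- First moment `∑_{n < N, 2 ∤ n} r'_k(n)` (Pintz–Ruzsa I (10.7), Lemma 14).
[cite: PintzRuzsa2003, Lemma 14] -/
def firstMoment (N k : ℕ) : ℕ := ∑ n ∈ oddBelow N, repPrimePow N k n

/-- Second moment `∑_{n < N, 2 ∤ n} r'_k(n)²` (Pintz–Ruzsa I (10.1), Lemma 13).
[cite: PintzRuzsa2003, Lemma 13] -/
def secondMoment (N k : ℕ) : ℕ := ∑ n ∈ oddBelow N, repPrimePow N k n ^ 2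

/-- The dispersion-method pair sum `∑_{m + n = N, 2 ∤ m, 2 ∤ n} r'_i(m) r'_j(n)`, written as a sum
over odd `m < N` with `n = N - m` (Pintz–Ruzsa I (10.10), where it equals `r''_{i+j}(N)`).
[cite: PintzRuzsa2003, (10.10)] -/
def pairSum (N i j : ℕ) : ℕ := ∑ m ∈ oddBelow N, repPrimePow N i m * repPrimePow N j (N - m)

/-! ### Elementary properties -/

/-- Membership in `oddPrimes`. [folklore] -/
theorem mem_oddPrimes {N p : ℕ} : p ∈ oddPrimes N ↔ p ≤ N ∧ p.Prime ∧ Odd p := by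
  simp [oddPrimes]

/-- Membership in `expTuples`. [folklore] -/
theorem mem_expTuples {N k : ℕ} {ν : Fin k → ℕ} :
    ν ∈ expTuples N k ↔ ∀ i, 1 ≤ ν i ∧ ν i ≤ powLen N := by
  simp [expTuples, Fintype.mem_piFinset]

/-- Membership in `oddBelow`. [folklore] -/
theorem mem_oddBelow {N n : ℕ} : n ∈ oddBelow N ↔ n < N ∧ Odd n := by
  simp [oddBelow]

/-- `#expTuples N k = L^k`. [folklore] -/
theorem card_expTuples (N k : ℕ) : (expTuples N k).card = powLen N ^ k := by
  simp [expTuples, Fintype.card_piFinset]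

/-- `2^L ≤ N` for `N ≠ 0`. [folklore] -/
theorem two_pow_powLen_le {N : ℕ} (hN : N ≠ 0) : 2 ^ powLen N ≤ N :=
  Nat.pow_log_le_self 2 hN

/-- A positive value of `r'_k(n)` produces a representation `n = p + 2^{ν₁} + ⋯ + 2^{ν_k}` with
`p ≤ N` an odd prime and `1 ≤ ν_i ≤ L`. [cite: PintzRuzsa2003, (1.2)] -/
theorem exists_rep_of_repPrimePow_pos {N k n : ℕ} (h : 0 < repPrimePow N k n) :
    ∃ p : ℕ, ∃ ν : Fin k → ℕ, p ∈ oddPrimes N ∧ ν ∈ expTuples N k ∧ p + ∑ i, 2 ^ ν i = n := by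
  obtain ⟨⟨p, ν⟩, hx⟩ := Finset.card_pos.1 h
  simp only [mem_filter, mem_product] at hx
  exact ⟨p, ν, hx.1.1, hx.1.2, hx.2⟩

/-- The numbers represented by `r'_k` are odd (odd prime plus powers `2^ν`, `ν ≥ 1`), so
`r'_k(n) = 0` for even `n`. [cite: PintzRuzsa2003, §1 (2 ∤ N in (1.2))] -/
theorem repPrimePow_eq_zero_of_even {N k n : ℕ} (hn : Even n) : repPrimePow N k n = 0 := by
  rw [repPrimePow, Finset.card_eq_zero, Finset.filter_eq_empty_iff]
  rintro ⟨p, ν⟩ hx hsum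
  simp only [mem_product] at hx
  have hp : Odd p := (mem_oddPrimes.1 hx.1).2.2
  have hν := mem_expTuples.1 hx.2
  have heven : Even (∑ i, 2 ^ ν i) := by
    refine Finset.even_sum _ fun i _ => ?_
    exact (Nat.even_pow' (by have := (hν i).1; omega)).2 even_two
  have : Odd n := by rw [← hsum]; exact hp.add_even heven
  exact (Nat.not_even_iff_odd.2 this) hn

/-- **Pintz–Ruzsa I, (10.10) ⇒ Theorem 1, last step.** A positive pair sum at an even `N`
yields `N = p₁ + p₂ + 2^{ν₁} + ⋯ + 2^{ν_{i+j}}` with odd primes `p₁, p₂ ≤ N` and `1 ≤ ν_l ≤ L`.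
[cite: PintzRuzsa2003, (10.10)] -/
theorem exists_rep_of_pairSum_pos {N i j : ℕ} (h : 0 < pairSum N i j) :
    ∃ p q : ℕ, ∃ e : Fin (i + j) → ℕ, p.Prime ∧ q.Prime ∧ (∀ l, 1 ≤ e l) ∧
      p + q + ∑ l, 2 ^ e l = N := by
  have hex : ∃ m ∈ oddBelow N, repPrimePow N i m * repPrimePow N j (N - m) ≠ 0 := by
    by_contra hcon
    push Not at hcon
    exact h.ne' (Finset.sum_eq_zero hcon)
  obtain ⟨m, hm, hne⟩ := hex
  have hm' : m < N := (mem_oddBelow.1 hm).1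
  obtain ⟨hi, hj⟩ := mul_ne_zero_iff.1 hne
  obtain ⟨p, ν, hp, hν, hpe⟩ := exists_rep_of_repPrimePow_pos (Nat.pos_of_ne_zero hi)
  obtain ⟨q, μ, hq, hμ, hqe⟩ := exists_rep_of_repPrimePow_pos (Nat.pos_of_ne_zero hj)
  refine ⟨p, q, Fin.append ν μ, (mem_oddPrimes.1 hp).2.1, (mem_oddPrimes.1 hq).2.1, ?_, ?_⟩
  · intro l
    refine Fin.addCases (fun l => ?_) (fun l => ?_) l
    · simpa only [Fin.append_left] using (mem_expTuples.1 hν l).1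
    · simpa only [Fin.append_right] using (mem_expTuples.1 hμ l).1
  · rw [Fin.sum_univ_add]
    simp only [Fin.append_left, Fin.append_right]
    omega

/-- **Reduction of `goldbach_linnik` to the positivity of the pair sum** (Pintz–Ruzsa I §10:
`r''_K(N) > 0` for `N > N₀` even, `K = i + j`; here `K ≤ 8` as in Part II). If
`∑_{m+n=N, 2∤mn} r'_i(m) r'_j(n) > 0` for all sufficiently large even `N` and `i + j ≤ 8`, then every
sufficiently large even `N` is a sum of two primes and at most `8` powers of two.
[cite: PintzRuzsa2003, §10 (proof of Theorem 1)] -/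
theorem goldbach_linnik_of_pairSum_pos {i j : ℕ} (hij : i + j ≤ 8)
    (h : ∃ N₀ : ℕ, ∀ N, N₀ ≤ N → Even N → 0 < pairSum N i j) : goldbach_linnik := by
  obtain ⟨N₀, hN₀⟩ := h
  refine ⟨N₀, fun N hN hE => ?_⟩
  obtain ⟨p, q, e, hp, hq, -, hsum⟩ := exists_rep_of_pairSum_pos (hN₀ N hN hE)
  exact ⟨p, q, i + j, e, hp, hq, hij, hsum⟩

/-! ### The index set of odd numbers below an even `N` -/

/-- For even `N`, `m ↦ N - m` maps the odd numbers below `N` to themselves. [folklore] -/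
theorem sub_mem_oddBelow {N m : ℕ} (hN : Even N) (hm : m ∈ oddBelow N) : N - m ∈ oddBelow N := by
  rw [mem_oddBelow] at hm ⊢
  obtain ⟨hlt, hodd⟩ := hm
  have h1 : 1 ≤ m := hodd.pos
  exact ⟨by omega, (Nat.odd_sub' hlt.le).2 (iff_of_true hodd hN)⟩

/-- Reindexing a sum over odd `m < N` by `m ↦ N - m` (`N` even). [folklore] -/
theorem sum_oddBelow_sub {N : ℕ} (hN : Even N) {M : Type*} [AddCommMonoid M] (f : ℕ → M) :
    ∑ m ∈ oddBelow N, f (N - m) = ∑ m ∈ oddBelow N, f m := by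
  refine Finset.sum_nbij' (fun m => N - m) (fun m => N - m) (fun m hm => sub_mem_oddBelow hN hm)
    (fun m hm => sub_mem_oddBelow hN hm) (fun m hm => ?_) (fun m hm => ?_) (fun m hm => rfl)
  · have := (mem_oddBelow.1 hm).1; omega
  · have := (mem_oddBelow.1 hm).1; omega

/-- `#{m < N : m odd} = N / 2`. [folklore] -/
theorem card_oddBelow (N : ℕ) : (oddBelow N).card = N / 2 := by
  induction N with
  | zero => simp [oddBelow]
  | succ n ih =>
    rw [oddBelow, Finset.range_add_one, Finset.filter_insert]
    split_ifs with h
    · rw [Finset.card_insert_of_notMem (by simp), ← oddBelow, ih]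
      obtain ⟨k, rfl⟩ := h
      omega
    · rw [← oddBelow, ih]
      obtain ⟨k, rfl⟩ := Nat.not_odd_iff_even.1 h
      omega

/-- For even `N`, `#{m < N : m odd} = N / 2` as a real number equals `N / 2`. [folklore] -/
theorem card_oddBelow_real {N : ℕ} (hN : Even N) : ((oddBelow N).card : ℝ) = (N : ℝ) / 2 := by
  rw [card_oddBelow]
  obtain ⟨k, rfl⟩ := hN
  rw [← two_mul, Nat.mul_div_cancel_left _ two_pos]
  push_cast
  ring

end GoldbachLinnik

end Literature.NumberTheory.Sieve
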